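import Literature.Computability.Complexity.PropFormArithmetization
import Literature.Barriers.QuantumAdvantage.AaronsonChenOracle
import HarnessLib

/-!
# The `IP = PSPACE` schedule of a prenex quantified Boolean formula: truth is the value of stage `0`

For a closed prenex formula `ψ = Q₀x₀ ⋯ Q_{N-1}x_{N-1} . φ` of the tree's `TQBF`
(`Literature.Barriers.QuantumAdvantage.PrenexQBF`, Arora–Barak Def. 4.10) this file fixes the data on
which the Shamir–Shen protocol is played (`ShenProtocolGame.lean`) and proves what the protocol needs:

* `TQBFShen.qlistFrom` — the prefix as a list of (quantifier, variable) pairs for `QBFArith.holds`, and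
  **`TQBFShen.holds_qlistFrom_iff`**: `QBFArith.holds` of the matrix predicate agrees with the tree's
  recursive evaluation `qbfEval` (both peel one quantifier and branch on both values);
* `TQBFShen.ops ψ = QBFArith.schedule (prefix) ++ QBFArith.sweep N` — Arora–Barak's operator
  expression (in the block form of `QBFArithmetization.lean`: one quantifier followed by a full
  linearization sweep, Sipser / Trevisan–Vadhan) with one more sweep innermost, so that the matrix
  handed to the quantifier blocks is multilinear; `TQBFShen.matrixPoly ψ = P_φ` (`PropForm.arith`);
  `length_ops` (`T = N(N+1) + N` rounds);
* **`TQBFShen.degreeOf_stage_ops_le`** — EVERY stage has degree `≤ degBound ψ = max 2 (size φ)` in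
  every variable (inner sweep: `≤ max 1 (size φ)`; quantifier blocks over a multilinear matrix: `≤ 2`,
  `QBFArith.degInv_schedule`) — the verifier's degree bound `d`;
* **`TQBFShen.eval_stage_ops_zero`** — at a Boolean point stage `0` is the indicator of the quantified
  formula (`QBFArith.eval_stage_schedule_zero` with `PropForm.eval_arith_bv`), whence
  **`eval_stage_ops_zero_of_isTrue`** (`= 1`) and **`eval_stage_ops_zero_of_not_isTrue`** (`= 0`) at the
  all-`false` point for CLOSED formulas: Arora–Barak's "(8.12) … `Ψ ∈ TQBF` if and only if … `≠ 0`",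
  in the Boolean-valued normalisation where the value is exactly `[Ψ true]`.

All proved; no named facts.

## References

* S. Arora, B. Barak, *Computational Complexity: A Modern Approach*, CUP 2009, §8.3.3 ((8.12) and the
  expression `∀_{X₁}L₁∃_{X₂}L₁L₂⋯`, PDF pp. 193–194), Def. 4.10 (`TQBF`).
* A. Shen, *IP = PSPACE: simplified proof*, J. ACM 39 (1992) 878–880.
-/

noncomputable section

namespace Literature.Computability.Complexity

open MvPolynomial QBFArith Literature.Barriers.QuantumAdvantage

open scoped Classical

namespace TQBFShen

variable {R : Type*} [CommRing R]

/-! ### The prefix as a `QBFArith` quantifier list -/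

/-- The quantifier prefix from position `k` on, as (quantifier, variable) pairs over `Fin N` (entries at
positions `≥ N` — absent when `N = |prefix|` — are dropped). [cite: AroraBarakCC2009, Def. 4.10] -/
def qlistFrom (N : ℕ) : ℕ → List Bool → List (Bool × Fin N)
  | _, [] => []
  | k, q :: qs => if h : k < N then (q, ⟨k, h⟩) :: qlistFrom N (k + 1) qs else []

/-- Length of the quantifier list: the whole remaining prefix when it fits below `N`. [folklore] -/
theorem length_qlistFrom (N : ℕ) : ∀ (qs : List Bool) (k : ℕ), k + qs.length ≤ N → (qlistFrom N k qs).length = qs.length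
  | [], _, _ => rfl
  | q :: qs, k, h => by
    have hk : k < N := by simp only [List.length_cons] at h; omega
    simp only [qlistFrom, hk, dif_pos, List.length_cons]
    rw [length_qlistFrom N qs (k + 1) (by simp only [List.length_cons] at h; omega)]

/-- The matrix predicate on Boolean points of `Fin N`. [cite: AroraBarakCC2009, §8.3.3] -/
def matrixPred (N : ℕ) (φ : PropForm ℕ) (b : Fin N → Bool) : Prop :=
  φ.eval (PropForm.extendAssign b) = true

/-- **`QBFArith.holds` agrees with the tree's `qbfEval`**: quantifying the variables `k, k+1, …` of the
prefix over the matrix predicate is the recursive evaluation of Arora–Barak's algorithm `A`.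
[cite: AroraBarakCC2009, Def. 4.10 and proof of Thm. 4.13] -/
theorem holds_qlistFrom_iff {N : ℕ} (φ : PropForm ℕ) :
    ∀ (qs : List Bool) (k : ℕ) (b : Fin N → Bool), k + qs.length ≤ N →
      (holds (matrixPred N φ) (qlistFrom N k qs) b ↔ qbfEval φ qs k (PropForm.extendAssign b) = true)
  | [], _, b, _ => Iff.rfl
  | q :: qs, k, b, h => by
    have hk : k < N := by simp only [List.length_cons] at h; omega
    have h' : (k + 1) + qs.length ≤ N := by simp only [List.length_cons] at h; omega
    have ih : ∀ c : Bool, holds (matrixPred N φ) (qlistFrom N (k + 1) qs) (Function.update b ⟨k, hk⟩ c) ↔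
        qbfEval φ qs (k + 1) (Function.update (PropForm.extendAssign b) k c) = true := fun c => by
      rw [holds_qlistFrom_iff φ qs (k + 1) _ h', PropForm.extendAssign_update]
    simp only [qlistFrom, hk, dif_pos]
    cases q
    · simp only [holds, ih, qbfEval, cond_false, Bool.or_eq_true, Bool.exists_bool]
    · simp only [holds, ih, qbfEval, cond_true, Bool.and_eq_true, Bool.forall_bool]

/-! ### The schedule, the matrix polynomial, the degree bound -/

/-- **The operator schedule of `ψ`**: the quantifier blocks of the prefix (outermost first, each followed
by a linearization sweep) and one more sweep innermost, applied to `P_φ`; `T = |ops ψ|` rounds.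
[cite: AroraBarakCC2009, §8.3.3 (the expression ∀X₁L₁∃X₂L₁L₂⋯)] -/
def ops (ψ : PrenexQBF) : List (Op ψ.quants.length) :=
  schedule (qlistFrom ψ.quants.length 0 ψ.quants) ++ sweep ψ.quants.length

/-- **The matrix polynomial `P_φ`** of `ψ` in the `N = |prefix|` variables. [cite: AroraBarakCC2009, §8.3.1] -/
def matrixPoly (ψ : PrenexQBF) : MvPolynomial (Fin ψ.quants.length) R :=
  PropForm.arith ψ.quants.length ψ.matrix

/-- **The verifier's degree bound** `d = max 2 (size φ)`. [cite: AroraBarakCC2009, §8.3.3 ("Let `d` be an upper bound (known to the verifier)")] -/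
def degBound (ψ : PrenexQBF) : ℕ :=
  max 2 ψ.matrix.size

/-- Length of a block schedule. [folklore] -/
theorem length_schedule {N : ℕ} (qs : List (Bool × Fin N)) : (schedule qs).length = qs.length * (N + 1) := by
  induction qs with
  | nil => simp [schedule]
  | cons q qs ih =>
    simp only [schedule, List.map_cons, List.flatten_cons, List.length_append, List.length_cons] at ih ⊢
    rw [ih, qblock, List.length_cons, sweep, List.length_map, List.length_finRange]
    ring

/-- **The number of rounds**: `T = N(N+1) + N`. [cite: AroraBarakCC2009, §8.3.3 ("The size of the expression is O(n²)")] -/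
theorem length_ops (ψ : PrenexQBF) :
    (ops ψ).length = ψ.quants.length * (ψ.quants.length + 1) + ψ.quants.length := by
  rw [ops, List.length_append, length_schedule, length_qlistFrom _ _ 0 (by simp), sweep, List.length_map,
    List.length_finRange]

/-- **Every stage of the schedule has degree `≤ d` in every variable.**
[cite: AroraBarakCC2009, §8.3.3 ("the intermediate polynomials arising … all have low degree")] -/
theorem degreeOf_stage_ops_le [Nontrivial R] (ψ : PrenexQBF) (i : ℕ) (u : Fin ψ.quants.length) :
    degreeOf u (stage (ops ψ) (matrixPoly ψ : MvPolynomial _ R) i) ≤ degBound ψ := by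
  have hP : ∀ w : Fin ψ.quants.length, degreeOf w (matrixPoly ψ : MvPolynomial _ R) ≤ ψ.matrix.size := fun w =>
    PropForm.degreeOf_arith_le w ψ.matrix
  unfold degBound
  by_cases hi : i ≤ (schedule (qlistFrom ψ.quants.length 0 ψ.quants)).length
  · -- inside the quantifier blocks: the matrix is the (multilinear) swept `P_φ`
    rw [ops, stage_append_of_le _ _ _ hi]
    have hlin : ∀ w : Fin ψ.quants.length,
        degreeOf w ((sweep ψ.quants.length).foldr applyOp (matrixPoly ψ : MvPolynomial _ R)) ≤ 2 := fun w =>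
      (degreeOf_foldr_sweep_le _ w).2.trans (by norm_num)
    exact (degInv_schedule _ _ hlin i u).trans (le_max_left _ _)
  · -- inside the innermost sweep
    push Not at hi
    rw [ops, stage_append_of_ge _ _ _ hi.le]
    refine (degreeOf_stage_sweep_le _ _ u).trans (max_le ?_ ((hP u).trans (le_max_right _ _)))
    exact le_trans (by norm_num) (le_max_left 2 _)

/-! ### Stage `0` is the truth value -/

/-- **At a Boolean point, stage `0` is the indicator of the quantified formula.**
[cite: AroraBarakCC2009, §8.3.3 (8.12)] -/
theorem eval_stage_ops_zero (ψ : PrenexQBF) (b : Fin ψ.quants.length → Bool) :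
    MvPolynomial.eval (bv b) (stage (ops ψ) (matrixPoly ψ : MvPolynomial _ R) 0) =
      if holds (matrixPred ψ.quants.length ψ.matrix) (qlistFrom ψ.quants.length 0 ψ.quants) b then 1 else 0 := by
  classical
  rw [ops, stage_append_of_le _ _ _ (Nat.zero_le _)]
  refine eval_stage_schedule_zero (matrixPred ψ.quants.length ψ.matrix) _ (fun b' => ?_) _ b
  rw [sweep, eval_foldr_lin_bv, matrixPoly, PropForm.eval_arith_bv]
  unfold matrixPred
  split_ifs <;> rfl

/-- **Truth of a closed formula is `QBFArith.holds` of its prefix** at the all-`false` point.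
[cite: AroraBarakCC2009, Def. 4.10] -/
theorem isTrue_iff_holds (ψ : PrenexQBF) :
    ψ.IsTrue ↔ holds (matrixPred ψ.quants.length ψ.matrix) (qlistFrom ψ.quants.length 0 ψ.quants) (fun _ => false) := by
  rw [holds_qlistFrom_iff ψ.matrix ψ.quants 0 _ (by simp), PropForm.extendAssign_false]
  rfl

/-- **If `ψ` is true, stage `0` at the all-`false` point is `1`** (the honest prover's initial claim).
[cite: AroraBarakCC2009, §8.3.3 (8.12)] -/
theorem eval_stage_ops_zero_of_isTrue {ψ : PrenexQBF} (h : ψ.IsTrue) :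
    MvPolynomial.eval (bv fun _ => false) (stage (ops ψ) (matrixPoly ψ : MvPolynomial _ R) 0) = 1 := by
  classical
  rw [eval_stage_ops_zero, if_pos ((isTrue_iff_holds ψ).1 h)]

/-- **If `ψ` is false, stage `0` at the all-`false` point is `0`**, so the claim "`= 1`" is false over
any nontrivial ring. [cite: AroraBarakCC2009, §8.3.3 (8.12)] -/
theorem eval_stage_ops_zero_of_not_isTrue {ψ : PrenexQBF} (h : ¬ ψ.IsTrue) :
    MvPolynomial.eval (bv fun _ => false) (stage (ops ψ) (matrixPoly ψ : MvPolynomial _ R) 0) = 0 := by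
  classical
  rw [eval_stage_ops_zero, if_neg (fun h' => h ((isTrue_iff_holds ψ).2 h'))]

end TQBFShen

end Literature.Computability.Complexity

end
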